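import Summits.HubbardSuperconductivity.HubbardSuperconductivity.Theorems.AnisotropyChordTransferFibre3Hole2Quarter

/-!
# Route `AnisotropyChord` / H0 rotor rung: HOLE₂(.75) at `L = 35` — kernel facts, part d (41 of the 170 `D₄`-classes)

KERNEL FACT for the twice-punctured `35 × 35` torus (zero data): the quarter-table interval Birman–Schwinger checker `Hole2.checkRepsQ`
(`…Fibre3Hole2Quarter`) accepts the listed separations at the certified constant `g_35 ≥ ¾ε₁(35)`, by ONE `decide +kernel`
(`maxHeartbeats 400000` pre-budgeted: the quarter Green table alone is ¾L³ interval operations, recomputed in each part).  The parts are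
glued in `…Hole2L35` and turned into `TwoHoleGap 35 (3/4·eps1 35)` by `Hole2.twoHoleGap_of_checkRepsQ_repList` (`…Fibre3Hole2Cover`).
`L = 35` lies just above the FIN range `9 ≤ L ≤ 32` (`…Hole2FinRange`); HOLE₂ per `L` is needed in the analytic regime as well.
Prover seat `hubbard-h0-rotor-p3` g3; helper for stmt-HubbardSuperconductivity-19089 (`--supports`, helper class).
WHAT THIS IS NOT: nothing here proves superconductivity in the Hubbard model (rotor TARGET as worded stays FALSE, g15 verdict);
kernel facts for ONE input (HOLE₂(.75) at one `L`) of ONE conditional reduction (rung 19089). Tree imports only; no sorry, no `native_decide`.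
-/

set_option linter.dupNamespace false
set_option autoImplicit false

namespace Summit.HubbardSuperconductivity.HubbardSuperconductivity.Theorems.AnisotropyChord.Transfer.Fibre3

namespace Hole2

/-- `D₄`-representatives of the nonzero separations of the `35 × 35` torus, part d. [folklore] -/
def reps35d : List (ℕ × ℕ) := [(15, 10), (15, 11), (15, 12), (15, 13), (15, 14), (15, 15), (16, 0), (16, 1), (16, 2), (16, 3), (16, 4), (16, 5), (16, 6), (16, 7), (16, 8), (16, 9), (16, 10), (16, 11), (16, 12), (16, 13), (16, 14), (16, 15), (16, 16), (17, 0), (17, 1), (17, 2), (17, 3), (17, 4), (17, 5), (17, 6), (17, 7), (17, 8), (17, 9), (17, 10), (17, 11), (17, 12), (17, 13), (17, 14), (17, 15), (17, 16), (17, 17)]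

set_option maxHeartbeats 400000 in
/-- kernel fact: part d passes the quarter-table interval Birman–Schwinger test at `g_35 ≥ ¾ε₁(35)`. [folklore] -/
theorem checkRepsQ_35d : checkRepsQ 35 reps35d = true := by
  decide +kernel

end Hole2

end Summit.HubbardSuperconductivity.HubbardSuperconductivity.Theorems.AnisotropyChord.Transfer.Fibre3
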